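import Literature.NumberTheory.EllipticCurves.HuShuYin2019.SylvesterThreePart
import Literature.NumberTheory.EllipticCurves.QuadraticTwistRank
import Literature.NumberTheory.EllipticCurves.Heights
import Literature.NumberTheory.EllipticCurves.MordellWeil
import HarnessLib

/-!
# Hu–Shu–Yin 2019: the Heegner-height display (bsd) for `E_p : x³ + y³ = p` at the prime `2`

Topic `NumberTheory/EllipticCurves/HuShuYin2019` (companion of `SylvesterThreePart.lean`, which
carries Thm. 1.4 = the `3`-part as the named fact `thm14_threePart_product`). This file states, as ONE
named fact in the SAME currency (`B ≅ E_p`, `A ≅ E_{3p²}` globally minimal over `ℚ`,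
`RHS(bsd1) = #Ш_an(B)·#Ш_an(A)` = the tree's `shaAn`), the `2`-adic information the paper proves
about that product: the display (bsd) of p. 12,
`|Ш(E_p)|·|Ш(E_{3p²})| = 2^i·ĥ_ℚ(R)/ĥ_ℚ(P)` "expected" — i.e. `RHS(bsd1) = 2^i·ĥ_ℚ(R)/ĥ_ℚ(P)` PROVED,
from the explicit Gross–Zagier formula Thm. 4.3 / Cor. 4.4 and the local data of [ZK] — together with
the rank statement of p. 8 (from Dasgupta–Voight) that makes the height ratio a norm from `K = ℚ(√−3)`.

* `shaAnPair_mul_height_eq_two_zpow_mul_height` — the named fact (a `Prop`; consumers take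
  `(h : shaAnPair_mul_height_eq_two_zpow_mul_height)`; no `_holds`: the proof is the paper's §§2–5,
  CM points on `X_0(3⁵)`, Shimura reciprocity, the explicit Gross–Zagier formula of Cai–Shu–Tian and
  local period integrals at `3` — none of it in the tree).

Consumers: `Summits/BirchSwinnertonDyer/BirchSwinnertonDyer/Theorems/SylvesterTwoHeegnerIndexTwoAdicPair*`
(route `SylvesterTwoHeegnerIndex`, item `TwoAdicPairHSY`: the PARITY of `ord₂(#Ш_an(B)·#Ш_an(A))` for
every member and its value `2n`, `n ≥ 0`, on `p ≡ 4 (mod 9)` follow from this fact by the Néron–Tate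
norm form of the CM action and the inertness of `2` in `ℤ[ω]`).

WHAT THIS IS NOT: not a proof; not BSD(E_p, 2) (the display is the RIGHT side of (bsd1) only; the left
side `|Ш(E_p)|·|Ш(E_{3p²})|` is the conjecture); `Y` is asserted to EXIST only (see the docstring).

## References

* [HuShuYin2019] Y. Hu, J. Shu, H. Yin, *An explicit Gross–Zagier formula related to the Sylvester
  conjecture*, Trans. Amer. Math. Soc. 372 (2019), arXiv:1708.05266: Thm. 1.3, (bsd1) p. 3, p. 4
  (`[ω](x,y) = (ωx, y)`), p. 8 (the point `Y`, `K ⊗_{O_K} E_p(K) ≃ K`), Thm. 4.3 / Cor. 4.4 (p. 11),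
  proof of Thm. 1.4 and display (bsd) (p. 12).
* [DV17] S. Dasgupta, J. Voight, *Sylvester's problem and mock Heegner points*, Proc. AMS 146 (2018)
  (the rank statements quoted on p. 8 of [HuShuYin2019]).
-/

open scoped Classical

open WeierstrassCurve WeierstrassCurve.Affine WeierstrassCurve.Affine.Point

namespace Literature.NumberTheory.EllipticCurves.HuShuYin2019

/-- **Hu–Shu–Yin, Trans. AMS 372 (2019): the display (bsd) (p. 12), with Thm. 4.3 / Cor. 4.4 (p. 11),
p. 8 and Thm. 1.3**, for a prime `p ≡ 4, 7 (mod 9)` such that `3` is not a cube modulo `p`, with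
`E_p : y² = x³ − 432p²`, `E_{3p²} : y² = x³ − 432·9p⁴`, `K = ℚ(√−3) = ℚ(ω)`. VERBATIM: p. 2 «Let `P`
be a generator of the free part of `E_p(ℚ)`» (rank `1`: Thm. 1.3(1)); p. 8 «the point `Y = R − T`
belongs to `E_1(L_{(p)})^{σ_{ω₃} = ω^α}` which is identified with `E_p(K)` under the isomorphism
`(x,y) ↦ ((∛p)²x, py)`» and «By the work of Dasgupta and Voight [DV17], we know that the free
component of `E_p(K)` has rank `1` over `O_K`, and we have `K ⊗_{O_K} E_p(K) ≃ K`»; Cor. 4.4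
«`L'(1,E_p)L(1,E_{3p²})/(Ω_pΩ_{3p²}) = 2^α·9·ĥ_ℚ(R)`, `α = 0` if `p ≡ 4 mod 9` and `α = −1` if
`p ≡ 7 mod 9`»; p. 12 «By Theorem 4.3 and Corollary 4.4, we expect (bsd)
`|Ш(E_p)|·|Ш(E_{3p²})| = 2^i ĥ_ℚ(R)/ĥ_ℚ(P)`, where `i = 0` resp. `i = −2` if `p ≡ 4 mod 9` resp.
`p ≡ 7 mod 9`. Note the RHS of (bsd) is a nonzero rational number.» — (bsd) being the product
(bsd1) (p. 3) of the two BSD formulas with the constants `c_p(E_p) = 3`, `c₃(E_p) = 1 | 2`,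
`c_p(E_{3p²}) = 3`, all other `c_ℓ = 1`, trivial torsion ([ZK], p. 12) inserted, i.e. what is
PROVED there is `RHS(bsd1) = 2^i·ĥ_ℚ(R)/ĥ_ℚ(P)`.
TRANSCRIPTION (tree currency, as in `thm14_threePart_product`: `B ≅ E_p`, `A ≅ E_{3p²}` globally
minimal over `ℚ`, `RHS(bsd1) = #Ш_an(B)·#Ш_an(A)` — Miller's analytic orders `shaAn`): `K` is any
number field with `[K:ℚ] = 2` containing `ω`, `ω² + ω + 1 = 0` (i.e. `K ≅ ℚ(√−3)`); heights are the
tree's Néron–Tate heights RELATIVE TO `K` on `B_K = B.baseChange K` (`ĥ_K = 2·ĥ_ℚ` on `ℚ`-points,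
`canonicalHeight_baseChange`; the printed RATIO `ĥ_ℚ(R)/ĥ_ℚ(P) = ĥ_ℚ(Y)/ĥ_ℚ(P)` — `T` torsion, the
identification an isomorphism of curves — equals `ĥ_K(Y)/ĥ_K(P)`), so the display reads
`(#Ш_an(B)·#Ш_an(A))·ĥ_K(ι P) = 2^i·ĥ_K(Y)`; «free component of rank `1` over `O_K`» reads
`rank_ℤ B(K) = 2` (`mordellWeilRank`); «generator of the free part» reads `P ∈ B(ℚ)` non-torsion
with `B(ℚ) = ℤP + torsion`, both written through the injective group homomorphism
`ι = QuadraticDescent.incl K B : B(ℚ) → B(K)` so that only ONE group structure (that of `B(K)`)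
occurs (the tree's convention of `QuadraticTwistRank`, design note). WEAKER THAN PRINT: `Y` is only asserted to EXIST in `B(K)` —
TODO(general form): `Y` is the explicit point `φ'(R − T)`, `R = Tr_{H_{3p}/L_{(p)}} φ(P₀)` of p. 8
(CM points on `X_0(3⁵)`, ring class fields — no tree carrier yet). STATUS PUB (Trans. AMS).
[cite: HuShuYin2019, display (bsd) p. 12 with Cor. 4.4 (p. 11), p. 8, Thm. 1.3]
[file NumberTheory/EllipticCurves/HuShuYin2019/SylvesterHeegnerHeightDisplay] -/
def shaAnPair_mul_height_eq_two_zpow_mul_height : Prop :=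
  ∀ (p : ℕ), p.Prime → (p % 9 = 4 ∨ p % 9 = 7) → (¬ ∃ x : ZMod p, x ^ 3 = 3) →
    ∀ (A B : WeierstrassCurve ℚ) [A.IsElliptic] [A.IsGloballyMinimal]
      [B.IsElliptic] [B.IsGloballyMinimal],
      (∃ C : VariableChange ℚ, C • B = cubeSumCurve (p : ℚ)) →
      (∃ C : VariableChange ℚ, C • A = cubeSumCurve (3 * (p : ℚ) ^ 2)) →
    ∀ (K : Type) [Field K] [NumberField K] (ω : K), ω ^ 2 + ω + 1 = 0 → Module.finrank ℚ K = 2 →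
      ∃ qB qA : ℚ, shaAn B = (qB : ℂ) ∧ shaAn A = (qA : ℂ) ∧ qB * qA ≠ 0 ∧
        (B.baseChange K).mordellWeilRank = 2 ∧
        ∃ (P : B.toAffine.Point) (Y : (B.baseChange K).toAffine.Point),
          ¬ IsOfFinAddOrder (WeierstrassCurve.QuadraticDescent.incl K B P) ∧
          (∀ Q : B.toAffine.Point, ∃ m : ℤ, IsOfFinAddOrder
            (WeierstrassCurve.QuadraticDescent.incl K B Q -
              m • WeierstrassCurve.QuadraticDescent.incl K B P)) ∧
          ((qB * qA : ℚ) : ℝ) * canonicalHeight (WeierstrassCurve.QuadraticDescent.incl K B P) =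
            (2 : ℝ) ^ (if p % 9 = 4 then (0 : ℤ) else -2) * canonicalHeight Y

end Literature.NumberTheory.EllipticCurves.HuShuYin2019
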